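import Mathlib
import Summits.ResolutionOfSingularities.ResolutionOfSingularities.Theorems.AbhyankarShadowsSemivaluationShadowsExactSpecialisation
import HarnessLib

/-!
# Minimal-degree exact specialisation over an abstract base field
(registered sub-goal `exists_minimal_exact_specialisation_of_algebra`; crux `SemivaluationShadows`, line `birth`)

The abstract-base-field form of `exists_minimal_exact_specialisation`
(`AbhyankarShadowsSemivaluationShadowsExactSpecialisation.lean`): the base field `F₀` is given with its
structure map `F₀ → M` (`Algebra F₀ M`) instead of as a subfield of `M`; the statement is transported
along the range equivalence `F₀ ≃ (algebraMap F₀ M).fieldRange`. This is the form consumed by the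
ruled-case assemblies of the crux (`stub_ruledShadowsRankOne`, `stub_henselOverRuledShadowsRankOne`,
`stub_ruledOverAbhyankarBaseShadows`), whose base `K₀` is an intermediate field of `K` mapped into
`M = AlgebraicClosure K`. (Filed as its own module because the append to the parent file, p169253,
is stalled in the queue; identical text.)

## Sources
* folklore (transport of structure); the mathematics is in the parent file (MacLane 1936 §§5–8 /
  Vaquié 2007 Thm 1.13, minimal-degree approximants).
-/

set_option linter.dupNamespace false -- mandated namespace of this single-conjunct summit

namespace Summit.ResolutionOfSingularities.ResolutionOfSingularities.Theorems

open Polynomial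

/-- Transport of `Polynomial.aeval` along the range equivalence of the structure map. [folklore] -/
theorem aeval_map_rangeRestrictFieldEquiv {F₀ M : Type*} [Field F₀] [Field M] [Algebra F₀ M]
    (f : F₀[X]) (x : M) :
    Polynomial.aeval x (f.map (algebraMap F₀ M).rangeRestrictFieldEquiv.toRingHom) =
      Polynomial.aeval x f := by
  rw [aeval_def, aeval_def, eval₂_map]
  rfl

/-- **Minimal approximants over an abstract base field.** As `exists_minimal_exact_specialisation`, with
the base field `F₀` given abstractly together with its structure map `F₀ → M` (`Algebra F₀ M`): if
every value of the algebraically closed valued field `(M, w)` is torsion over the values of `F₀` and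
every residue of `M` is represented in `F₀`, then every `y ∈ M` transcendental over `F₀` specialises,
for any finite set `S` of non-zero polynomials over `F₀`, to an element `ρ'` ALGEBRAIC over `F₀` which
is exact on `S` and on every non-zero polynomial of degree `< deg (minpoly F₀ ρ')`. (Registered
sub-goal form for the ruled-case assembly of the crux `SemivaluationShadows`.) [folklore] -/
theorem exists_minimal_exact_specialisation_of_algebra : ∀ {F₀ M Γ₀ : Type*} [Field F₀] [Field M] [IsAlgClosed M] [Algebra F₀ M] [LinearOrderedCommGroupWithZero Γ₀] (w : Valuation M Γ₀), (∀ z : M, z ≠ 0 → ∃ N : ℕ, N ≠ 0 ∧ ∃ b : F₀, w z ^ N = w (algebraMap F₀ M b)) → (∀ u : M, w u = 1 → ∃ c : F₀, w (u - algebraMap F₀ M c) < 1) → ∀ {y : M}, Transcendental F₀ y → ∀ (S : Finset (Polynomial F₀)), (∀ f ∈ S, f ≠ 0) → ∃ ρ' : M, IsAlgebraic F₀ ρ' ∧ (∀ f ∈ S, w (Polynomial.aeval ρ' f) = w (Polynomial.aeval y f)) ∧ ∀ g : Polynomial F₀, g ≠ 0 → g.natDegree < (minpoly F₀ ρ').natDegree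 → w (Polynomial.aeval ρ' g) = w (Polynomial.aeval y g) := by
  intro F₀ M Γ₀ _ _ _ _ _ w htors hres y hy S hS0
  classical
  let K₀' : Subfield M := (algebraMap F₀ M).fieldRange
  let e : F₀ ≃+* K₀' := (algebraMap F₀ M).rangeRestrictFieldEquiv
  -- transport of `aeval` in both directions
  have haeval : ∀ (f : F₀[X]) (x : M),
      Polynomial.aeval x (f.map e.toRingHom) = Polynomial.aeval x f :=
    fun f x => aeval_map_rangeRestrictFieldEquiv f x
  have haeval' : ∀ (q : K₀'[X]) (x : M),
      Polynomial.aeval x (q.map e.symm.toRingHom) = Polynomial.aeval x q := by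
    intro q x
    have := haeval (q.map e.symm.toRingHom) x
    rw [Polynomial.map_map] at this
    have hid : e.toRingHom.comp e.symm.toRingHom = RingHom.id _ := by ext; simp
    rw [hid, Polynomial.map_id] at this
    exact this.symm
  -- hypotheses of the subfield version
  have htors' : ∀ z : M, z ≠ 0 → ∃ N : ℕ, N ≠ 0 ∧ ∃ b ∈ K₀', w z ^ N = w b := by
    intro z hz
    obtain ⟨N, hN, b, hb⟩ := htors z hz
    exact ⟨N, hN, algebraMap F₀ M b, ⟨b, rfl⟩, hb⟩
  have hres' : ∀ u : M, w u = 1 → ∃ c ∈ K₀', w (u - c) < 1 := by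
    intro u hu
    obtain ⟨c, hc⟩ := hres u hu
    exact ⟨algebraMap F₀ M c, ⟨c, rfl⟩, hc⟩
  have hy' : ¬ IsAlgebraic K₀' y := by
    rintro ⟨q, hq0, hq⟩
    refine hy ⟨q.map e.symm.toRingHom, ?_, ?_⟩
    · exact (Polynomial.map_ne_zero_iff e.symm.injective).mpr hq0
    · rw [haeval']; exact hq
  let S' : Finset K₀'[X] := S.image (Polynomial.map e.toRingHom)
  have hS0' : ∀ f ∈ S', f ≠ 0 := by
    intro f hf
    obtain ⟨g, hg, rfl⟩ := Finset.mem_image.mp hf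
    exact (Polynomial.map_ne_zero_iff e.injective).mpr (hS0 g hg)
  obtain ⟨ρ', hρ'alg, hS, hdeg⟩ :=
    exists_minimal_exact_specialisation w K₀' htors' hres' hy' S' hS0'
  -- transport of the conclusion
  have hρ'algF : IsAlgebraic F₀ ρ' := by
    obtain ⟨q, hq0, hq⟩ := hρ'alg
    refine ⟨q.map e.symm.toRingHom, (Polynomial.map_ne_zero_iff e.symm.injective).mpr hq0, ?_⟩
    rw [haeval']; exact hq
  have hdegle : (minpoly F₀ ρ').natDegree ≤ (minpoly K₀' ρ').natDegree := by
    have hint : IsIntegral K₀' ρ' := hρ'alg.isIntegral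
    have hmon : ((minpoly K₀' ρ').map e.symm.toRingHom).Monic := (minpoly.monic hint).map _
    have hroot : Polynomial.aeval ρ' ((minpoly K₀' ρ').map e.symm.toRingHom) = 0 := by
      rw [haeval', minpoly.aeval]
    have h := minpoly.min F₀ ρ' hmon hroot
    calc (minpoly F₀ ρ').natDegree ≤ ((minpoly K₀' ρ').map e.symm.toRingHom).natDegree :=
          Polynomial.natDegree_le_natDegree h
      _ = (minpoly K₀' ρ').natDegree := Polynomial.natDegree_map_eq_of_injective e.symm.injective _
  refine ⟨ρ', hρ'algF, fun f hf => ?_, fun g hg0 hgdeg => ?_⟩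
  · have h := hS (f.map e.toRingHom) (Finset.mem_image.mpr ⟨f, hf, rfl⟩)
    rwa [haeval, haeval] at h
  · have hnd : (g.map e.toRingHom).natDegree = g.natDegree :=
      Polynomial.natDegree_map_eq_of_injective e.injective g
    have h := hdeg (g.map e.toRingHom) ((Polynomial.map_ne_zero_iff e.injective).mpr hg0)
      (hnd ▸ hgdeg.trans_le hdegle)
    rwa [haeval, haeval] at h

end Summit.ResolutionOfSingularities.ResolutionOfSingularities.Theorems
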